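import Mathlib
import HarnessLib
import Summits.HubbardSuperconductivity.HubbardSuperconductivity.Theorems.KLProgrammeC4aAntidiagonalFlatnessL1

/-!
# Route `KLProgramme` — crux C4a, S3 brick (B4) «(B4)-UMK1», «(M1)-TRUE-KERNEL»: the anti-diagonal flatness number WITH A C¹ LEVEL WEIGHT —
# the `hflat` shape `|∫ w(e)·∂ᵤK(e, D−e) de|` of `…C4aPreCausticLevelLine`, reduced to the unweighted weighted-L¹ lemma with one extra `w′` term

Cell `gate-hubbard-kl`, seat hubbard-kl-k3c3-p1 (g15; row «δμ-flow with klAngularMean constant piece»).  Companion of `…C4aAntidiagonalFlatnessL1` (p674073) for the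
(U1) chain of hubbard-kl-k3c3-p3 (stub (C) of stmt-HubbardSuperconductivity-20437).  p662264 `abs_intervalIntegral_deformed_antidiagonal_le` carries a level weight `w`
(`0 ≤ w ≤ W`, the loop line's shell/tube profile) inside its flatness hypothesis `|∫ w(e)·Ku e (D−e) de| ≤ A_fl`; the unweighted identity absorbs a CONSTANT weight only.
For `w ∈ C¹` the same integration by parts applies to `ñ = w·n` (`ñ′ = (w·n₁ + w′·n) − w·n₂`), so:
* **`abs_integral_antidiagonal_flatness_weighted_le_of_L1`** — boundary `w(D)·n(D)·κ(1) = 0`;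
  `|∫_0^D w·Ku| ≤ (M₁ + M₂ + M₃)/D²` with `M₁ = ∫_0^D |w·n₁·κ(e/D)|·e`, `M₂ = ∫_0^D |w·n₂·κ(e/D)|·(D−e)`, and the WEIGHT-VARIATION term
  `M₃ = ∫_0^D |w′·n·κ(e/D)|·e` — zero when `w` is constant where the split profile lives (adaptation (b) of the note `M1-TRUE-KERNEL.md` §4, now a checkable hypothesis:
  for the true kernel `|n| ≤ 1` on the quadrant, so `M₃ ≤ κ₀·sup_{[0,t₁D]}|w′|·(t₁D)²/2`).
Pure real analysis; nothing asserts (C), K3 or superconductivity.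
References: FST II CPAM 51 (1998) §3 [cite: FeldmanSalmhoferTrubowitz1998]; Salmhofer 1999 §4.5.3 [cite: Salmhofer1999].
-/

noncomputable section

namespace Summit.HubbardSuperconductivity.HubbardSuperconductivity.Theorems.C4a

set_option linter.dupNamespace false -- summit = problem name (single-conjunct summit), D-0017

open Real Set MeasureTheory intervalIntegral
open scoped Interval

/-- **THE FLATNESS NUMBER WITH A C¹ LEVEL WEIGHT.**  `0 < D`; along `[0,D]`: `n′ = n₁ − n₂` (continuous densities), `κ ∈ C¹`, `w ∈ C¹`, boundary
`w(D)·n(D)·κ(1) = 0`, `Ku(e) = n₂κ(e/D)/D − n(κ′(e/D)(e/D) + κ(e/D))/D²`; weighted-L¹ data `∫_0^D |w n₁ κ(e/D)|·e ≤ M₁`, `∫_0^D |w n₂ κ(e/D)|·(D−e) ≤ M₂`,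
`∫_0^D |w′ n κ(e/D)|·e ≤ M₃`.  THEN `|∫_0^D w·Ku| ≤ (M₁ + M₂ + M₃)/D²`. [cite: FeldmanSalmhoferTrubowitz1998, §3] -/
theorem abs_integral_antidiagonal_flatness_weighted_le_of_L1 {n n₁ n₂ κ κ' w w' Ku : ℝ → ℝ} {D M₁ M₂ M₃ : ℝ} (hD : 0 < D)
    (hn : ∀ e ∈ Icc 0 D, HasDerivAt n (n₁ e - n₂ e) e) (hn₁c : Continuous n₁) (hn₂c : Continuous n₂)
    (hκ : ∀ t, HasDerivAt κ (κ' t) t) (hκ'c : Continuous κ')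
    (hw : ∀ e, HasDerivAt w (w' e) e) (hw'c : Continuous w') (hnc : Continuous n)
    (hbd : w D * n D * κ 1 = 0)
    (hKu : ∀ e ∈ Icc 0 D, Ku e = n₂ e * κ (e / D) / D - n e * (κ' (e / D) * (e / D) + κ (e / D)) / D ^ 2)
    (hM₁ : ∫ e in (0 : ℝ)..D, |w e * n₁ e * κ (e / D)| * e ≤ M₁) (hM₂ : ∫ e in (0 : ℝ)..D, |w e * n₂ e * κ (e / D)| * (D - e) ≤ M₂)
    (hM₃ : ∫ e in (0 : ℝ)..D, |w' e * n e * κ (e / D)| * e ≤ M₃) :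
    |∫ e in (0 : ℝ)..D, w e * Ku e| ≤ (M₁ + M₂ + M₃) / D ^ 2 := by
  have hwc : Continuous w := continuous_iff_continuousAt.2 fun e => (hw e).continuousAt
  have hκc : Continuous κ := continuous_iff_continuousAt.2 fun t => (hκ t).continuousAt
  have hκDc : Continuous fun e : ℝ => κ (e / D) := hκc.comp (continuous_id.div_const D)
  -- the weighted numerator `ñ = w·n` and its line derivatives
  have hñ : ∀ e ∈ Icc (0 : ℝ) D, HasDerivAt (fun x => w x * n x) ((w e * n₁ e + w' e * n e) - w e * n₂ e) e := fun e he => by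
    have h := (hw e).mul (hn e he)
    refine h.congr_deriv ?_
    ring
  have hñ₁c : Continuous fun e => w e * n₁ e + w' e * n e := (hwc.mul hn₁c).add (hw'c.mul hnc)
  have hñ₂c : Continuous fun e => w e * n₂ e := hwc.mul hn₂c
  have hbd' : (fun x => w x * n x) D * κ 1 = 0 := by simpa [mul_assoc] using hbd
  have hKu' : ∀ e ∈ Icc (0 : ℝ) D, w e * Ku e =
      (w e * n₂ e) * κ (e / D) / D - (fun x => w x * n x) e * (κ' (e / D) * (e / D) + κ (e / D)) / D ^ 2 := fun e he => by
    rw [hKu e he]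
    simp only
    ring
  -- the weighted-L¹ data of `ñ₁`
  have hi₁ : IntervalIntegrable (fun e => |w e * n₁ e * κ (e / D)| * e) volume 0 D :=
    ((((hwc.mul hn₁c).mul hκDc).abs).mul continuous_id).intervalIntegrable _ _
  have hi₃ : IntervalIntegrable (fun e => |w' e * n e * κ (e / D)| * e) volume 0 D :=
    ((((hw'c.mul hnc).mul hκDc).abs).mul continuous_id).intervalIntegrable _ _
  have hM₁' : ∫ e in (0 : ℝ)..D, |(w e * n₁ e + w' e * n e) * κ (e / D)| * e ≤ M₁ + M₃ := by
    have hle : ∫ e in (0 : ℝ)..D, |(w e * n₁ e + w' e * n e) * κ (e / D)| * e ≤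
        ∫ e in (0 : ℝ)..D, (|w e * n₁ e * κ (e / D)| * e + |w' e * n e * κ (e / D)| * e) := by
      refine intervalIntegral.integral_mono_on hD.le ?_ (hi₁.add hi₃) fun e he => ?_
      · exact (((((hwc.mul hn₁c).add (hw'c.mul hnc)).mul hκDc).abs).mul continuous_id).intervalIntegrable _ _
      · have he0 : 0 ≤ e := he.1
        rw [← add_mul]
        refine mul_le_mul_of_nonneg_right ?_ he0
        rw [show (w e * n₁ e + w' e * n e) * κ (e / D) = w e * n₁ e * κ (e / D) + w' e * n e * κ (e / D) by ring]
        exact abs_add_le _ _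
    rw [intervalIntegral.integral_add hi₁ hi₃] at hle
    linarith
  have h := abs_integral_antidiagonal_flatness_le_of_L1 (n := fun x => w x * n x) (n₁ := fun e => w e * n₁ e + w' e * n e)
    (n₂ := fun e => w e * n₂ e) (κ := κ) (κ' := κ') (Ku := fun e => w e * Ku e) hD hñ hñ₁c hñ₂c hκ hκ'c hbd' hKu' hM₁' hM₂
  refine h.trans (le_of_eq ?_)
  ring

end Summit.HubbardSuperconductivity.HubbardSuperconductivity.Theorems.C4a

end
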